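import Literature.Analysis.FunctionSpaces.SmoothParametricIntegral
import Mathlib.Analysis.SpecialFunctions.Integrals.Basic
import Mathlib.Topology.ContinuousMap.Weierstrass
import Mathlib.Algebra.Polynomial.Eval.Degree
import HarnessLib

/-!
# Schlömilch's integral equation

Support file (everything proved, no named facts) for the explicit vacuum spacetime of
`Literature.Geometry.Lorentzian.christodoulou_trapped_surface_formation_holds`.

For a smooth `g : ℝ → ℝ` the **Schlömilch transform**
`B[g](τ) = g(0) + (τ/2) ∫₀^π g'(τ sin φ) dφ` (`schB`) solves **Schlömilch's integral equation**
`(1/π) ∫₀^π β(r sin φ) dφ = g(r)` (`schS (schB g) = g`, `Schloemilch.schS_schB`):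
Whittaker–Watson, *A Course of Modern Analysis*, §11.81 (written there over `[0, π/2]` with the
factor `2/π`; by the symmetry `φ ↦ π − φ` this is the same equation). Proof: for polynomials the
identity is Wallis' product `(∫₀^π sinᵐ⁺¹)(∫₀^π sinᵐ) = 2π/(m+1)` (`wallis_mul`), monomial by
monomial (`schS_schB_polyS`); a smooth `g` is approximated on `[−|r|, |r|]` in the `C¹` sense by
polynomials (Weierstrass, Mathlib's `exists_polynomial_near_of_continuousOn`, applied to `g'` and
integrated), and both sides are continuous for that approximation. The transform of a smooth
function is smooth (`contDiff_schB`, differentiation under the integral sign), even when `g` is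
even (`schB_neg`), and vanishes on `[−R, R]` when `g` is constant there (`schB_eq_zero_of_const`).
In `GowdyPulse.lean` it produces the plane-wave profile whose superposition has the prescribed
Cauchy datum `g` (the datum of the superposition is `schS β`, `PlaneWaveExterior.lean`).

## References

* E. T. Whittaker, G. N. Watson, *A Course of Modern Analysis*, 4th ed., CUP 1927, §11.81
  (Schlömilch's integral equation). [WhittakerWatson1927]
-/

noncomputable section

open Set Filter MeasureTheory intervalIntegral Real Finset
open scoped Topology ContDiff

namespace Literature.Geometry.Lorentzian

namespace Schloemilch

open Literature.Analysis.FunctionSpaces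

/-! ### Wallis' product -/

/-- `Wp j = ∫₀^π sinʲ`. [folklore] -/
def Wp (j : ℕ) : ℝ := ∫ x in (0 : ℝ)..π, sin x ^ j

/-- `Wp 0 = π`. [folklore] -/
theorem Wp_zero : Wp 0 = π := by simp [Wp]

/-- `Wp 1 = 2`. [folklore] -/
theorem Wp_one : Wp 1 = 2 := by
  simp only [Wp, pow_one, integral_sin, cos_zero, cos_pi]
  norm_num

/-- The recursion `Wp (n+2) = (n+1)/(n+2) Wp n` (Mathlib's `integral_sin_pow`). [folklore] -/
theorem Wp_succ_succ (n : ℕ) : Wp (n + 2) = (n + 1) / (n + 2) * Wp n := by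
  have h := integral_sin_pow (a := 0) (b := π) (n := n)
  simp only [sin_zero, sin_pi, zero_pow (Nat.succ_ne_zero n), zero_mul, sub_zero, zero_div,
    zero_add] at h
  exact h

/-- **Wallis' product**: `Wp (m+1) * Wp m = 2π/(m+1)`. [folklore] -/
theorem wallis_mul (m : ℕ) : Wp (m + 1) * Wp m = 2 * π / (m + 1) := by
  induction m with
  | zero => rw [Wp_one, Wp_zero]; norm_num
  | succ k ih =>
    rw [show k + 1 + 1 = k + 2 from rfl, Wp_succ_succ, mul_assoc, mul_comm (Wp k), ih]
    have h1 : (k : ℝ) + 1 ≠ 0 := by positivity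
    have h2 : (k : ℝ) + 2 ≠ 0 := by positivity
    push_cast
    field_simp
    ring

/-- `∫₀^π (r sin φ)ʲ dφ = rʲ Wp j`. [folklore] -/
theorem integral_mul_sin_pow (r : ℝ) (j : ℕ) :
    ∫ x in (0 : ℝ)..π, (r * sin x) ^ j = r ^ j * Wp j := by
  simp only [mul_pow, Wp]
  exact intervalIntegral.integral_const_mul _ _

/-! ### The transforms -/

/-- **Schlömilch's mean** `S[β](r) = (1/π) ∫₀^π β(r sin φ) dφ` (the Cauchy datum of the
plane-wave superposition of profile `β`). [cite: WhittakerWatson1927, §11.81] -/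
def schS (β : ℝ → ℝ) (r : ℝ) : ℝ := π⁻¹ * ∫ x in (0 : ℝ)..π, β (r * sin x)

/-- **Schlömilch's transform** `B[g](τ) = g(0) + (τ/2) ∫₀^π g'(τ sin φ) dφ`, the solution of
Schlömilch's integral equation `S[β] = g`. [cite: WhittakerWatson1927, §11.81] -/
def schB (g : ℝ → ℝ) (τ : ℝ) : ℝ := g 0 + τ / 2 * ∫ x in (0 : ℝ)..π, deriv g (τ * sin x)

variable {g β : ℝ → ℝ}

/-- The derivative of a smooth function is smooth. [folklore] -/
theorem contDiff_deriv (hg : ContDiff ℝ ∞ g) : ContDiff ℝ ∞ (deriv g) :=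
  (contDiff_infty_iff_deriv.1 hg).2

/-- **The Schlömilch transform of a smooth function is smooth** (differentiation under the
integral sign). [folklore] -/
theorem contDiff_schB (hg : ContDiff ℝ ∞ g) : ContDiff ℝ ∞ (schB g) := by
  unfold schB
  refine contDiff_const.add ((contDiff_id.div_const 2).mul ?_)
  exact contDiff_parametric_intervalIntegral_comp (P := ℝ) (contDiff_deriv hg)
    (A := fun p : ℝ × ℝ ↦ p.2 * sin p.1) (by fun_prop) 0 π

/-- The Schlömilch mean of a continuous profile is continuous. [folklore] -/
theorem continuous_schS (hβ : Continuous β) : Continuous (schS β) := by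
  unfold schS
  refine continuous_const.mul ?_
  exact intervalIntegral.continuous_parametric_intervalIntegral_of_continuous'
    (f := fun r x ↦ β (r * sin x))
    (show Continuous (fun p : ℝ × ℝ ↦ β (p.1 * sin p.2)) by fun_prop) 0 π

/-- The transform of an even function is even (`g'` is odd). [folklore] -/
theorem schB_neg (heven : ∀ x, g (-x) = g x) (τ : ℝ) :
    schB g (-τ) = schB g τ := by
  have hodd : ∀ x, deriv g (-x) = -deriv g x := by
    intro x
    have h1 : deriv (fun y ↦ g (-y)) (-x) = -deriv g (- -x) := by
      rw [deriv_comp_neg]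
    have h2 : (fun y ↦ g (-y)) = g := funext heven
    rw [h2, neg_neg] at h1
    exact h1
  unfold schB
  congr 1
  have : ∫ x in (0 : ℝ)..π, deriv g (-τ * sin x) = -∫ x in (0 : ℝ)..π, deriv g (τ * sin x) := by
    rw [← intervalIntegral.integral_neg]
    refine intervalIntegral.integral_congr fun x _ ↦ ?_
    simp only [neg_mul, hodd]
  rw [this]
  ring

/-- If `g` is constant on `[−R, R]` then `B[g] = g(0)·1 − … = g 0 + 0`: precisely, `B[g](τ) = g 0`
for `|τ| ≤ R` (`g' = 0` on `(−R, R)` and at the endpoints by continuity). [folklore] -/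
theorem schB_eq_of_const (hg : ContDiff ℝ ∞ g) {k R : ℝ} (hR : 0 < R)
    (hconst : ∀ x, |x| ≤ R → g x = k) (τ : ℝ) (hτ : |τ| ≤ R) : schB g τ = k := by
  have hg0 : g 0 = k := hconst 0 (by simpa using hR.le)
  -- `g' = 0` on `[−R, R]`
  have hderiv0 : ∀ x, |x| ≤ R → deriv g x = 0 := by
    -- on the open interval by local constancy, at the endpoints by continuity of `g'`
    have hopen : ∀ x, |x| < R → deriv g x = 0 := by
      intro x hx
      have hev : g =ᶠ[𝓝 x] fun _ ↦ k := by
        have : Ioo (-R) R ∈ 𝓝 x := Ioo_mem_nhds (by linarith [neg_abs_le x, abs_lt.1 hx |>.1])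
          (abs_lt.1 hx).2
        filter_upwards [this] with y hy using hconst y (abs_le.2 ⟨hy.1.le, hy.2.le⟩)
      rw [hev.deriv_eq, deriv_const]
    intro x hx
    rcases hx.lt_or_eq with hlt | heq
    · exact hopen x hlt
    · -- endpoint: `deriv g` is continuous and vanishes on a punctured side
      have hc : Continuous (deriv g) := (contDiff_deriv hg).continuous
      have hx0 : x ≠ 0 := by intro h; rw [h, abs_zero] at heq; linarith
      -- approach `x` from inside along `y n = x (1 - 1/(n+2))`
      have hlim : Tendsto (fun n : ℕ ↦ x * (1 - 1 / ((n : ℝ) + 2))) atTop (𝓝 x) := by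
        have h1 : Tendsto (fun n : ℕ ↦ (1 : ℝ) / ((n : ℝ) + 2)) atTop (𝓝 0) := by
          have := tendsto_one_div_add_atTop_nhds_zero_nat (𝕜 := ℝ)
          have h2 : Tendsto (fun n : ℕ ↦ n + 1) atTop atTop := tendsto_add_atTop_nat 1
          have h3 := this.comp h2
          refine h3.congr fun n ↦ ?_
          simp only [Function.comp_apply]
          push_cast
          ring_nf
        have h2 : Tendsto (fun n : ℕ ↦ x * (1 - 1 / ((n : ℝ) + 2))) atTop (𝓝 (x * (1 - 0))) :=
          (tendsto_const_nhds.sub h1).const_mul x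
        simpa using h2
      have hvals : ∀ n : ℕ, deriv g (x * (1 - 1 / ((n : ℝ) + 2))) = 0 := by
        intro n
        apply hopen
        have hpos : 0 < 1 - 1 / ((n : ℝ) + 2) := by
          have : (1 : ℝ) / ((n : ℝ) + 2) < 1 := by
            rw [div_lt_one (by positivity)]; linarith [n.cast_nonneg (α := ℝ)]
          linarith
        have hlt1 : 1 - 1 / ((n : ℝ) + 2) < 1 := by
          have : 0 < (1 : ℝ) / ((n : ℝ) + 2) := by positivity
          linarith
        rw [abs_mul, abs_of_pos hpos, heq]
        calc R * (1 - 1 / ((n : ℝ) + 2)) < R * 1 := by gcongr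
          _ = R := mul_one R
      have h := (hc.tendsto x).comp hlim
      have h' : Tendsto (fun n : ℕ ↦ deriv g (x * (1 - 1 / ((n : ℝ) + 2)))) atTop (𝓝 0) := by
        simp_rw [hvals]; exact tendsto_const_nhds
      exact tendsto_nhds_unique h h'
  unfold schB
  rw [hg0]
  have : ∫ x in (0 : ℝ)..π, deriv g (τ * sin x) = 0 := by
    have h : EqOn (fun x ↦ deriv g (τ * sin x)) (fun _ ↦ (0 : ℝ)) (uIcc 0 π) := fun x _ ↦ by
      apply hderiv0
      rw [abs_mul]
      calc |τ| * |sin x| ≤ |τ| * 1 := by gcongr; exact abs_sin_le_one x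
        _ ≤ R := by linarith
    rw [intervalIntegral.integral_congr h, intervalIntegral.integral_zero]
  rw [this, mul_zero, add_zero]

/-! ### The identity for polynomials -/

/-- Polynomial functions in the shifted form `a₀ + ∑_{i<n} a_{i+1} x^{i+1}`. [folklore] -/
def polyS (a : ℕ → ℝ) (n : ℕ) (x : ℝ) : ℝ := a 0 + ∑ i ∈ range n, a (i + 1) * x ^ (i + 1)

/-- The derivative of `polyS`: `∑_{i<n} a_{i+1} (i+1) xⁱ`. [folklore] -/
theorem hasDerivAt_polyS (a : ℕ → ℝ) (n : ℕ) (x : ℝ) :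
    HasDerivAt (polyS a n) (∑ i ∈ range n, a (i + 1) * ((i + 1) * x ^ i)) x := by
  have hsum : HasDerivAt (fun y ↦ ∑ i ∈ range n, a (i + 1) * y ^ (i + 1))
      (∑ i ∈ range n, a (i + 1) * ((i + 1) * x ^ i)) x := by
    have h := HasDerivAt.fun_sum (u := range n)
      (A := fun i y ↦ a (i + 1) * y ^ (i + 1))
      (A' := fun i ↦ a (i + 1) * ((i + 1) * x ^ i)) (x := x) fun i _ ↦ ?_
    · exact h
    · have := (hasDerivAt_pow (i + 1) x).const_mul (a (i + 1))
      simpa [Nat.add_sub_cancel] using this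
  have h := (hasDerivAt_const x (a 0)).add hsum
  simp only [zero_add] at h
  exact h

/-- `deriv polyS`. [folklore] -/
theorem deriv_polyS (a : ℕ → ℝ) (n : ℕ) (x : ℝ) :
    deriv (polyS a n) x = ∑ i ∈ range n, a (i + 1) * ((i + 1) * x ^ i) :=
  (hasDerivAt_polyS a n x).deriv

/-- `polyS a n 0 = a 0`. [folklore] -/
theorem polyS_zero (a : ℕ → ℝ) (n : ℕ) : polyS a n 0 = a 0 := by
  simp [polyS]

/-- **The transform of a polynomial**: `B[polyS](τ) = a₀ + ∑ a_{i+1} ((i+1)/2) Wp i · τ^{i+1}`.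
[cite: WhittakerWatson1927, §11.81] -/
theorem schB_polyS (a : ℕ → ℝ) (n : ℕ) (τ : ℝ) :
    schB (polyS a n) τ = a 0 + ∑ i ∈ range n, a (i + 1) * ((i + 1) / 2 * Wp i) * τ ^ (i + 1) := by
  unfold schB
  rw [polyS_zero]
  simp_rw [deriv_polyS]
  rw [intervalIntegral.integral_finsetSum]
  · rw [Finset.mul_sum]
    congr 1
    refine Finset.sum_congr rfl fun i _ ↦ ?_
    have : ∫ x in (0 : ℝ)..π, a (i + 1) * ((i + 1) * (τ * sin x) ^ i) =
        a (i + 1) * ((i + 1) * (τ ^ i * Wp i)) := by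
      rw [intervalIntegral.integral_const_mul, intervalIntegral.integral_const_mul,
        integral_mul_sin_pow]
    rw [this]
    ring
  · intro i _
    exact (Continuous.intervalIntegrable (by fun_prop) _ _)

/-- **Schlömilch's identity for polynomials**: `S[B[polyS]] = polyS`, by Wallis' product.
[cite: WhittakerWatson1927, §11.81] -/
theorem schS_schB_polyS (a : ℕ → ℝ) (n : ℕ) (r : ℝ) : schS (schB (polyS a n)) r = polyS a n r := by
  unfold schS
  simp_rw [schB_polyS]
  rw [intervalIntegral.integral_add intervalIntegrable_const
    ((Continuous.intervalIntegrable (by fun_prop) _ _)), intervalIntegral.integral_const, smul_eq_mul,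
    sub_zero, intervalIntegral.integral_finsetSum]
  · unfold polyS
    rw [mul_add, Finset.mul_sum]
    congr 1
    · field_simp
    · refine Finset.sum_congr rfl fun i _ ↦ ?_
      rw [intervalIntegral.integral_const_mul, integral_mul_sin_pow]
      have hw := wallis_mul i
      have hi : (i : ℝ) + 1 ≠ 0 := by positivity
      have hπ : π ≠ 0 := pi_ne_zero
      -- `π⁻¹ · a ((i+1)/2 Wp i) · r^{i+1} Wp (i+1) = a r^{i+1}`
      have : (i + 1) / 2 * Wp i * Wp (i + 1) = π := by
        rw [mul_assoc, mul_comm (Wp i), hw]; field_simp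
      calc π⁻¹ * (a (i + 1) * ((i + 1) / 2 * Wp i) * (r ^ (i + 1) * Wp (i + 1)))
          = π⁻¹ * ((i + 1) / 2 * Wp i * Wp (i + 1)) * (a (i + 1) * r ^ (i + 1)) := by ring
        _ = a (i + 1) * r ^ (i + 1) := by rw [this, inv_mul_cancel₀ hπ, one_mul]
  · intro i _
    exact (Continuous.intervalIntegrable (by fun_prop) _ _)

/-! ### The identity for smooth functions -/

/-- `C¹`-closeness on `[−R, R]` is inherited by the transforms: if `|g' − f'| ≤ ε` on `[−R, R]`
and `g 0 = f 0` then `|B[g](τ) − B[f](τ)| ≤ (R π / 2) ε` for `|τ| ≤ R`. [folklore] -/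
theorem abs_schB_sub_le {f : ℝ → ℝ} {R ε : ℝ} (hR : 0 ≤ R) (h0 : g 0 = f 0)
    (hgc : Continuous (deriv g)) (hfc : Continuous (deriv f))
    (hclose : ∀ x, |x| ≤ R → |deriv g x - deriv f x| ≤ ε) (τ : ℝ) (hτ : |τ| ≤ R) :
    |schB g τ - schB f τ| ≤ R * π / 2 * ε := by
  unfold schB
  have hig : IntervalIntegrable (fun x ↦ deriv g (τ * sin x)) volume (0 : ℝ) π :=
    (show Continuous (fun x ↦ deriv g (τ * sin x)) by fun_prop).intervalIntegrable _ _
  have hif : IntervalIntegrable (fun x ↦ deriv f (τ * sin x)) volume (0 : ℝ) π :=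
    (show Continuous (fun x ↦ deriv f (τ * sin x)) by fun_prop).intervalIntegrable _ _
  rw [h0, add_sub_add_left_eq_sub, ← mul_sub, ← intervalIntegral.integral_sub hig hif]
  have hint : |∫ x in (0 : ℝ)..π, (deriv g (τ * sin x) - deriv f (τ * sin x))| ≤ ε * |π - 0| := by
    have := intervalIntegral.norm_integral_le_of_norm_le_const (a := (0 : ℝ)) (b := π) (C := ε)
      (f := fun x ↦ deriv g (τ * sin x) - deriv f (τ * sin x)) fun x _ ↦ by
        rw [Real.norm_eq_abs]
        apply hclose
        rw [abs_mul]
        calc |τ| * |sin x| ≤ |τ| * 1 := by gcongr; exact abs_sin_le_one x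
          _ ≤ R := by linarith
    simpa [Real.norm_eq_abs] using this
  rw [sub_zero, abs_of_pos pi_pos] at hint
  rw [abs_mul, abs_div, abs_two]
  have hε : 0 ≤ ε := by
    have := hclose 0 (by simpa using hR)
    exact (abs_nonneg _).trans this
  calc |τ| / 2 * |∫ x in (0 : ℝ)..π, (deriv g (τ * sin x) - deriv f (τ * sin x))|
      ≤ R / 2 * (ε * π) := by gcongr
    _ = R * π / 2 * ε := by ring

/-- **Schlömilch's theorem.** For smooth `g`, `β = B[g]` solves Schlömilch's integral equation:
`(1/π) ∫₀^π β(r sin φ) dφ = g(r)` for every `r` (Whittaker–Watson §11.81: polynomials by Wallis'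
product, the general case by `C¹`-approximation on `[−|r|, |r|]`). [cite: WhittakerWatson1927, §11.81] -/
theorem schS_schB (hg : ContDiff ℝ ∞ g) (r : ℝ) : schS (schB g) r = g r := by
  -- reduce to an `ε`-estimate
  refine eq_of_abs_sub_le_all ?_
  intro ε hε
  set R : ℝ := |r| + 1 with hR
  have hR0 : 0 < R := by positivity
  have hgc : Continuous (deriv g) := (contDiff_deriv hg).continuous
  -- Weierstrass for `g'` on `[−R, R]`
  set ε' : ℝ := ε / (R * π / 2 * 1 + R + 1) with hε'
  have hden : 0 < R * π / 2 * 1 + R + 1 := by positivity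
  have hε'0 : 0 < ε' := div_pos hε hden
  obtain ⟨p, hp⟩ := exists_polynomial_near_of_continuousOn (-R) R (deriv g) hgc.continuousOn ε' hε'0
  -- the antiderivative polynomial with value `g 0` at `0`
  set d := p.natDegree + 1 with hd
  set a : ℕ → ℝ := fun i ↦ Nat.casesOn i (g 0) fun j ↦ p.coeff j / (j + 1) with ha
  set f := polyS a d with hf
  have ha0 : a 0 = g 0 := rfl
  have hasucc : ∀ j, a (j + 1) = p.coeff j / (j + 1) := fun j ↦ rfl
  have hf' : ∀ x, deriv f x = p.eval x := by
    intro x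
    rw [hf, deriv_polyS, Polynomial.eval_eq_sum_range]
    refine Finset.sum_congr rfl fun i _ ↦ ?_
    rw [hasucc]
    have : (i : ℝ) + 1 ≠ 0 := by positivity
    field_simp
  have hfc : Continuous (deriv f) := by
    rw [show deriv f = fun x ↦ p.eval x from funext hf']
    exact p.continuous
  have hclose : ∀ x, |x| ≤ R → |deriv g x - deriv f x| ≤ ε' := by
    intro x hx
    rw [hf', abs_sub_comm]
    exact (hp x (abs_le.1 hx |> fun h ↦ ⟨by linarith [h.1], h.2⟩)).le
  have hf0 : g 0 = f 0 := by rw [hf, polyS_zero]; exact ha0.symm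
  -- (1) `S[B g] r` is close to `S[B f] r`
  have hBc : Continuous (schB g) := (contDiff_schB hg).continuous
  have hBfc : Continuous (schB f) := by
    have : ContDiff ℝ ∞ f := by
      rw [hf]; unfold polyS; fun_prop
    exact (contDiff_schB this).continuous
  have h1 : |schS (schB g) r - schS (schB f) r| ≤ R * π / 2 * ε' := by
    unfold schS
    have hi1 : IntervalIntegrable (fun x ↦ schB g (r * sin x)) volume (0 : ℝ) π :=
      (show Continuous (fun x ↦ schB g (r * sin x)) by fun_prop).intervalIntegrable _ _
    have hi2 : IntervalIntegrable (fun x ↦ schB f (r * sin x)) volume (0 : ℝ) π :=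
      (show Continuous (fun x ↦ schB f (r * sin x)) by fun_prop).intervalIntegrable _ _
    rw [← mul_sub, ← intervalIntegral.integral_sub hi1 hi2]
    have hint := intervalIntegral.norm_integral_le_of_norm_le_const (a := (0 : ℝ)) (b := π)
      (C := R * π / 2 * ε') (f := fun x ↦ schB g (r * sin x) - schB f (r * sin x)) fun x _ ↦ by
        rw [Real.norm_eq_abs]
        refine abs_schB_sub_le hR0.le hf0 hgc hfc hclose _ ?_
        rw [abs_mul]
        calc |r| * |sin x| ≤ |r| * 1 := by gcongr; exact abs_sin_le_one x
          _ ≤ R := by rw [hR]; linarith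
    rw [sub_zero, Real.norm_eq_abs, abs_of_pos pi_pos] at hint
    rw [abs_mul, abs_inv, abs_of_pos pi_pos]
    calc π⁻¹ * |∫ x in (0 : ℝ)..π, (schB g (r * sin x) - schB f (r * sin x))|
        ≤ π⁻¹ * (R * π / 2 * ε' * π) := by gcongr
      _ = R * π / 2 * ε' := by field_simp
  -- (2) `S[B f] r = f r`
  have h2 : schS (schB f) r = f r := by rw [hf]; exact schS_schB_polyS a d r
  -- (3) `f r` is close to `g r` (integrate `f' − g'` from `0` to `r`)
  have h3 : |f r - g r| ≤ R * ε' := by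
    have hgd : ∀ x, HasDerivAt g (deriv g x) x := fun x ↦
      ((hg.differentiable (by simp)) x).hasDerivAt
    have hfd : ∀ x, HasDerivAt f (deriv f x) x := fun x ↦ by
      rw [hf]; exact (hasDerivAt_polyS a d x).deriv ▸ hasDerivAt_polyS a d x
    have hFTCg := intervalIntegral.integral_eq_sub_of_hasDerivAt (a := 0) (b := r)
      (fun x _ ↦ hgd x) (hgc.intervalIntegrable _ _)
    have hFTCf := intervalIntegral.integral_eq_sub_of_hasDerivAt (a := 0) (b := r)
      (fun x _ ↦ hfd x) (hfc.intervalIntegrable _ _)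
    have hdiff : f r - g r = ∫ x in (0 : ℝ)..r, (deriv f x - deriv g x) := by
      rw [intervalIntegral.integral_sub (hfc.intervalIntegrable _ _) (hgc.intervalIntegrable _ _),
        hFTCf, hFTCg, ← hf0]
      ring
    rw [hdiff]
    have hint := intervalIntegral.norm_integral_le_of_norm_le_const (a := (0 : ℝ)) (b := r)
      (C := ε') (f := fun x ↦ deriv f x - deriv g x) fun x hx ↦ by
        rw [Real.norm_eq_abs, abs_sub_comm]
        refine hclose x ?_
        have hx' : |x| ≤ |r| := by
          rcases le_or_gt 0 r with hr | hr
          · rw [uIoc_of_le hr] at hx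
            rw [abs_of_nonneg hx.1.le, abs_of_nonneg hr]; exact hx.2
          · rw [uIoc_of_ge hr.le] at hx
            rw [abs_of_nonpos hx.2, abs_of_neg hr]; linarith [hx.1]
        rw [hR]; linarith
    rw [sub_zero, Real.norm_eq_abs] at hint
    calc |∫ x in (0 : ℝ)..r, (deriv f x - deriv g x)| ≤ ε' * |r| := hint
      _ ≤ ε' * R := by gcongr; rw [hR]; linarith
      _ = R * ε' := mul_comm _ _
  -- combine
  calc |schS (schB g) r - g r|
      = |(schS (schB g) r - schS (schB f) r) + (f r - g r)| := by rw [h2]; ring_nf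
    _ ≤ |schS (schB g) r - schS (schB f) r| + |f r - g r| := abs_add_le _ _
    _ ≤ R * π / 2 * ε' + R * ε' := add_le_add h1 h3
    _ ≤ (R * π / 2 * 1 + R + 1) * ε' := by nlinarith [hε'0.le]
    _ = ε := by rw [hε']; field_simp

/-- `S[β](0) = β 0`. [folklore] -/
theorem schS_zero (β : ℝ → ℝ) : schS β 0 = β 0 := by
  unfold schS
  simp only [zero_mul, intervalIntegral.integral_const, smul_eq_mul, sub_zero]
  field_simp

end Schloemilch

end Literature.Geometry.Lorentzian
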